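import Literature.NumberTheory.Automorphic.GL2CESHEval
import Literature.NumberTheory.Automorphic.GL2CCoeffRepSmooth
import Literature.NumberTheory.Automorphic.GL2CAutomorphicEval
import Literature.NumberTheory.Automorphic.GL2CCuspFormLowestKTypeIn
import HarnessLib

/-!
# The Eichler–Shimura–Harder family of a clean cuspidal `π` on `GL₂` over an imaginary quadratic
# field: definition, smoothness, and the derivative along one-parameter subgroups

**Data** (`GL2CESH.FamilyData`).  A clean automorphic representation datum `π = W / ⊥` of
`GL₂(𝔸_K)` (`K` totally complex with one infinite place), a weight family `λ`, the Lie-equivariant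
identification `Θ : Sym^d ⊗ \overline{Sym}^d ≃ E_λ(ℂ)` (`GL2CCoeffModelEquiv`), a `1`-cochain
`η : Fin 3 → model W d` of Kuga's relative complex for `W ⊗ (Sym^d ⊗ \overline{Sym}^d)` (the model
cochain `GL2CESH.eshCochain`, `eshCochain_model`) which is closed and level-`K(𝔫)`, and the centre
acting on `W` and `E_λ(ℂ)` by opposite scalars.

**The family.**  For `c ∈ GL₂(𝔸_K^∞)`, `X ∈ M₂(ℂ)` and `M ∈ M₂(ℂ)`:
`family c X M = E(M) Θ( η(X)(M, c) )` where `η(X) = ∑ xcoord X i • η i ∈ model W d` is read at the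
adelic point `pt M c` entrywise (`GL2CESH.mapModel`, `evalW`).  This file proves:

* `theta_mapModel_evalW` — expansion in the elementary vectors `Θ δ_{l,m}`;
* `contDiffOn_family` — **`M ↦ family c X M` is `C^∞` on `Inv`** (automorphic forms are smooth:
  `ImaginaryQuadratic.contDiffOn_complex_of_isArchSmooth`; `E(M) v` is smooth: `contDiffOn_coeffRepC`);
* `hasDerivAt_family_mul_expGL` — **the derivative along `M exp(sZ)`**:
  `d/ds|₀ family c X (g exp sZ) = E(g) ( Θ((ρ₁(Z) ⊗ 1) η(X))(g, c) + dE(φ_{w₀} Z) Θ(η(X)(g,c)) )`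
  (product rule with `hasDerivAt_pt_mul_expGL` and `hasDerivAt_coeffRepC_mul_expGL`), and its
  readings for `Z = x_i ∈ 𝔭₀` (Kuga's `D_i`), `Z = y_α ∈ 𝔰𝔲(2)` (Kuga's `𝔨`-operators) and the centre.
[cite: Harder1987, §3.1] [cite: BorelWallach2000, I §1.2, II §2.2 and VII §2.2]

Definitions with bodies (`FamilyData`, `O₁`, `ρ₁`, `setup`, `evalW`, `ηX`, `vec`, `family`) and theorems;
no named fact.
-/

noncomputable section

-- Mathlib idiom (Mathlib/Algebra/Lie/OfAssociative.lean), as in `GL2CCuspFormOps`.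
attribute [local instance 100] LieRing.ofAssociativeRing

open scoped Matrix ComplexConjugate MatrixGroups Topology Matrix.Norms.Operator ContDiff BigOperators
open Complex Filter Finset

namespace Literature.NumberTheory.Automorphic

namespace GL2CESH

open scoped Classical
open _root_.NumberField _root_.NumberField.InfinitePlace _root_.NumberField.mixedEmbedding IsDedekindDomain
open RealMatrixGroup ComplexPlace ImaginaryQuadratic GL2CCoeff GL2CAut GL2CKType GL2CCuspForm GL2C
open AutomorphicRepData GLnComplexCasimir GL2ComplexCasimir GL2CESHMat

variable (K : Type) [Field K] [NumberField K] [IsTotallyComplex K] (hcpt : isCompact_glFiniteIntegralLevel 2 K)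

/-- **The data of an Eichler–Shimura–Harder family** (see the module docstring).
[cite: Harder1987, §3.1] [cite: BorelWallach2000, VII §2.2] -/
structure FamilyData where
  /-- The automorphic representation datum `π = W / W'`. -/
  π : AutomorphicRepData (AutomorphyDatum.gl 2 K hcpt)
  /-- Cleanness: `W' = ⊥`. -/
  h : π.W' = ⊥
  /-- The Lie algebra action on `W / W'`. -/
  ρ𝔤 : (AutomorphyDatum.gl 2 K hcpt).arch.lie →ₗ⁅ℝ⁆ Module.End ℂ π.Quot
  /-- It is the action by Lie derivatives. -/
  hρ : π.HasLieAction ρ𝔤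
  /-- The weight family. -/
  lam : (K →+* ℂ) → Fin 2 → ℤ
  /-- `d = λ_{σ₀,0} − λ_{σ₀,1}`. -/
  d : ℕ
  /-- The identification of the coordinate model with the coefficient module. -/
  Θ : model ℂ d ≃ₗ[ℂ] ResGLnCohomology.CoeffModule ℂ 2 K lam
  /-- `Θ` intertwines the six operators. -/
  hΘ : Ops.Intertwines (Θ : model ℂ d →ₗ[ℂ] ResGLnCohomology.CoeffModule ℂ 2 K lam)
    (coeff (C := ℂ) d) (coeffOps K lam (complexPlace K))
  /-- The level. -/
  𝔫 : Ideal (𝓞 K)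
  /-- The level is non-zero. -/
  h𝔫 : 𝔫 ≠ 0
  /-- The cochain of the model. -/
  η : Fin 3 → model π.W d
  /-- Its entries are `K(𝔫)`-fixed. -/
  hfix : ∀ i l m, ((η i : ℕ → ℕ → π.W) l m) ∈ GL2CCuspForm.levelFixed π 𝔫
  /-- It is a `1`-cochain of Kuga's relative complex (infinitesimal `𝔨`-equivariance). -/
  hcoch : (GL2CKType.setup (aut (opsW π h ρ𝔤) d) (coeff (C := π.W) d)).IsCochain η
  /-- It is closed. -/
  hclosed : ∀ i j, (GL2CKType.setup (aut (opsW π h ρ𝔤) d) (coeff (C := π.W) d)).D i (η j) =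
    (GL2CKType.setup (aut (opsW π h ρ𝔤) d) (coeff (C := π.W) d)).D j (η i)
  /-- The scalar by which `1 ∈ 𝔤𝔩₂(K_{w₀})` acts on `W`. -/
  μ₁ : ℂ
  /-- `1` acts on `W` by `μ₁`. -/
  hμ₁ : ∀ φ : π.W, rhoAt (π.lieOnW h ρ𝔤) (complexPlace K) 1 φ = μ₁ • φ
  /-- `1` acts on `E_λ(ℂ)` by `−μ₁`. -/
  hμ₂ : ∀ v, coeffPlaceLie K lam (complexPlace K) 1 v = (-μ₁) • v
  /-- The scalar by which `i·1` acts on `W`. -/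
  ν₁ : ℂ
  /-- `i·1` acts on `W` by `ν₁`. -/
  hν₁ : ∀ φ : π.W, rhoAt (π.lieOnW h ρ𝔤) (complexPlace K) (I • 1) φ = ν₁ • φ
  /-- `i·1` acts on `E_λ(ℂ)` by `−ν₁`. -/
  hν₂ : ∀ v, coeffPlaceLie K lam (complexPlace K) (I • 1) v = (-ν₁) • v

namespace FamilyData

variable {K hcpt} (D : FamilyData K hcpt)

/-- The six operators on `W`. [folklore] -/
def O₁ : Ops D.π.W := opsW D.π D.h D.ρ𝔤

/-- The place action `ρ₁ : 𝔤𝔩₂(ℂ) → End W`. [folklore] -/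
def ρ₁ : Matrix (Fin 2) (Fin 2) ℂ →ₗ⁅ℝ⁆ Module.End ℂ D.π.W := rhoAt (D.π.lieOnW D.h D.ρ𝔤) (complexPlace K)

/-- `O₁ = opsOf (ofRho ρ₁)` (definitional). [folklore] -/
theorem O₁_eq : D.O₁ = opsOf (ofRho D.ρ₁) := rfl

/-- Kuga's setup of the model `W ⊗ (Sym^d ⊗ \overline{Sym}^d)`. [cite: BorelWallach2000, II §2.1–2.3] -/
def setup : Kuga.Setup (model D.π.W D.d) (Fin 3) (Fin 3) := GL2CKType.setup (aut D.O₁ D.d) (coeff (C := D.π.W) D.d)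

/-- `ρ₁(Z) φ` as a function is the Lie derivative along `φ_{w₀} Z`. [cite: BorelJacquet1979, §1.5] -/
theorem coe_ρ₁ (Z : Matrix (Fin 2) (Fin 2) ℂ) (φ : D.π.W) :
    ((D.ρ₁ Z φ : D.π.W) : (AdelicGroupData.gl 2 K).Adelic → ℂ) =
      lieDeriv (AutomorphyDatum.gl 2 K hcpt).ofArch (placeLie 2 (complexPlace K) Z) φ := by
  rw [ρ₁, rhoAt_apply, coe_lieOnW D.π D.h D.hρ]
  rfl

/-! ### Reading the model at a point -/

/-- Evaluation of `W` at an adelic point. [folklore] -/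
def evalW (x : (AdelicGroupData.gl 2 K).Adelic) : D.π.W →ₗ[ℂ] ℂ :=
  (LinearMap.proj x).comp D.π.W.subtype

/-- Unfolding. [folklore] -/
@[simp] theorem evalW_apply (x : (AdelicGroupData.gl 2 K).Adelic) (φ : D.π.W) :
    D.evalW x φ = (φ : (AdelicGroupData.gl 2 K).Adelic → ℂ) x := rfl

/-- `η(X) = ∑ xcoord X i • η i`. [cite: Harder1987, §3.1] -/
def ηX (X : Mat) : model D.π.W D.d := ∑ i, ((xcoord X i : ℝ) : ℂ) • D.η i

/-- `η(X)` is real-linear in `X`. [folklore] -/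
theorem ηX_add (X Y : Mat) : D.ηX (X + Y) = D.ηX X + D.ηX Y := by
  simp only [ηX, ← Finset.sum_add_distrib, ← add_smul]
  refine Finset.sum_congr rfl fun i _ => ?_
  have : xcoord (X + Y) i = xcoord X i + xcoord Y i := by rw [← xcoordLM_apply, map_add]; rfl
  rw [this]; push_cast; rfl

/-- `η(X)` is real-linear in `X`. [folklore] -/
theorem ηX_smul (r : ℝ) (X : Mat) : D.ηX (r • X) = (r : ℂ) • D.ηX X := by
  simp only [ηX, Finset.smul_sum, smul_smul]
  refine Finset.sum_congr rfl fun i _ => ?_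
  have : xcoord (r • X) i = r * xcoord X i := by rw [← xcoordLM_apply, map_smul]; rfl
  rw [this]; push_cast; rfl

/-- The vector `Θ(η(X)(x)) ∈ E_λ(ℂ)`. [cite: Harder1987, §3.1] -/
def vec (X : Mat) (x : (AdelicGroupData.gl 2 K).Adelic) : ResGLnCohomology.CoeffModule ℂ 2 K D.lam :=
  D.Θ (mapModel D.d (D.evalW x) (D.ηX X))

/-- **The family** `family c X M = E(M) Θ(η(X)(M, c))`. [cite: Harder1987, §3.1] [cite: BorelWallach2000, VII §2.2] -/
def family (c : BigHeckeGLn.FiniteAdelicGL 2 K) : Mat →ₗ[ℝ] (Mat → ResGLnCohomology.CoeffModule ℂ 2 K D.lam) where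
  toFun X M := coeffRepC K D.lam (toGL M) (D.vec X (pt K (toGL M) c))
  map_add' X Y := funext fun M => by
    simp only [vec, ηX_add, map_add, Pi.add_apply]
  map_smul' r X := funext fun M => by
    simp only [vec, ηX_smul, map_smul, Pi.smul_apply, RingHom.id_apply, Complex.coe_smul, LinearMap.map_smul_of_tower]

/-- Unfolding. [folklore] -/
theorem family_apply (c : BigHeckeGLn.FiniteAdelicGL 2 K) (X M : Mat) :
    D.family c X M = coeffRepC K D.lam (toGL M) (D.vec X (pt K (toGL M) c)) := rfl

/-- **Expansion in elementary vectors**: `Θ(u(x)) = ∑_{l,m ≤ d} u_{l,m}(x) • Θ δ_{l,m}`. [folklore] -/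
theorem theta_mapModel_evalW (u : model D.π.W D.d) (x : (AdelicGroupData.gl 2 K).Adelic) :
    D.Θ (mapModel D.d (D.evalW x) u) =
      ∑ l ∈ range (D.d + 1), ∑ m ∈ range (D.d + 1),
        (((u : ℕ → ℕ → D.π.W) l m : D.π.W) : (AdelicGroupData.gl 2 K).Adelic → ℂ) x • D.Θ (Ops.single D.d l m) := by
  conv_lhs => rw [Ops.eq_sum_single D.d (mapModel D.d (D.evalW x) u)]
  simp only [map_sum, map_smul, mapModel_apply, evalW_apply]

/-- The family, expanded. [folklore] -/
theorem family_eq_sum (c : BigHeckeGLn.FiniteAdelicGL 2 K) (X M : Mat) :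
    D.family c X M = ∑ l ∈ range (D.d + 1), ∑ m ∈ range (D.d + 1),
      (((D.ηX X : ℕ → ℕ → D.π.W) l m : D.π.W) : (AdelicGroupData.gl 2 K).Adelic → ℂ) (pt K (toGL M) c) •
        coeffRepC K D.lam (toGL M) (D.Θ (Ops.single D.d l m)) := by
  rw [family_apply, vec, theta_mapModel_evalW]
  simp only [map_sum, map_smul]

/-! ### Smoothness -/

/-- **`M ↦ family c X M` is smooth on `Inv`.** [cite: BorelWallach2000, VII §2.2] -/
theorem contDiffOn_family (h2 : Module.finrank ℚ K = 2) (c : BigHeckeGLn.FiniteAdelicGL 2 K) (X : Mat)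
    {n : ℕ∞} : ContDiffOn ℝ n (D.family c X) Inv := by
  have hK : Subsingleton (InfinitePlace K) := subsingleton_infinitePlace K h2
  have hfun : D.family c X = fun M => ∑ l ∈ range (D.d + 1), ∑ m ∈ range (D.d + 1),
      (((D.ηX X : ℕ → ℕ → D.π.W) l m : D.π.W) : (AdelicGroupData.gl 2 K).Adelic → ℂ) (pt K (toGL M) c) •
        coeffRepC K D.lam (toGL M) (D.Θ (Ops.single D.d l m)) := funext fun M => D.family_eq_sum c X M
  rw [hfun]
  refine ContDiffOn.sum fun l _ => ContDiffOn.sum fun m _ => ?_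
  refine ContDiffOn.fun_smul ?_ (contDiffOn_coeffRepC K D.lam hK _)
  set φ : D.π.W := (D.ηX X : ℕ → ℕ → D.π.W) l m
  have hφ := D.π.isArchSmooth_of_mem_W φ.2
  refine (contDiffOn_complex_of_isArchSmooth (n := 2) h2 hφ (GLn.ofFinite 2 K c) (F := fun M =>
    ((φ : D.π.W) : (AdelicGroupData.gl 2 K).Adelic → ℂ) (pt K (toGL M) c)) fun M h => ?_).of_le
    (by exact_mod_cast le_top)
  rw [toGL_eq h]
  rfl

/-! ### The derivative along one-parameter subgroups -/

/-- **The derivative of the family along `g exp(sZ)`**, expanded form. [cite: Harder1987, §3.1] -/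
theorem hasDerivAt_family_mul_expGL_sum (h2 : Module.finrank ℚ K = 2) (c : BigHeckeGLn.FiniteAdelicGL 2 K)
    (X Z : Mat) (g : GL (Fin 2) ℂ) :
    HasDerivAt (fun s : ℝ => coeffRepC K D.lam (g * expGL (s • Z)) (D.vec X (pt K (g * expGL (s • Z)) c)))
      (∑ l ∈ range (D.d + 1), ∑ m ∈ range (D.d + 1),
        ((((D.ηX X : ℕ → ℕ → D.π.W) l m : D.π.W) : (AdelicGroupData.gl 2 K).Adelic → ℂ) (pt K g c) •
            coeffRepC K D.lam g (coeffPlaceLie K D.lam (complexPlace K) Z (D.Θ (Ops.single D.d l m))) +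
          lieDeriv (AutomorphyDatum.gl 2 K hcpt).ofArch (placeLie 2 (complexPlace K) Z)
              (((D.ηX X : ℕ → ℕ → D.π.W) l m : D.π.W) : (AdelicGroupData.gl 2 K).Adelic → ℂ) (pt K g c) •
            coeffRepC K D.lam g (D.Θ (Ops.single D.d l m)))) 0 := by
  have hK : Subsingleton (InfinitePlace K) := subsingleton_infinitePlace K h2
  have hfun : (fun s : ℝ => coeffRepC K D.lam (g * expGL (s • Z)) (D.vec X (pt K (g * expGL (s • Z)) c))) =
      fun s => ∑ l ∈ range (D.d + 1), ∑ m ∈ range (D.d + 1),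
        (((D.ηX X : ℕ → ℕ → D.π.W) l m : D.π.W) : (AdelicGroupData.gl 2 K).Adelic → ℂ) (pt K (g * expGL (s • Z)) c) •
          coeffRepC K D.lam (g * expGL (s • Z)) (D.Θ (Ops.single D.d l m)) := by
    funext s
    rw [vec, theta_mapModel_evalW]
    simp only [map_sum, map_smul]
  rw [hfun]
  refine HasDerivAt.fun_sum fun l _ => HasDerivAt.fun_sum fun m _ => ?_
  set φ : D.π.W := (D.ηX X : ℕ → ℕ → D.π.W) l m
  have hφ := D.π.isArchSmooth_of_mem_W φ.2
  have h1 := hasDerivAt_pt_mul_expGL hK hφ g c Z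
  have h2' := hasDerivAt_coeffRepC_mul_expGL K D.lam hK g Z (D.Θ (Ops.single D.d l m))
  have h3 := h1.smul h2'
  rw [zero_smul, expGL_zero, mul_one] at h3
  exact h3

/-- **The derivative of the family along `g exp(sZ)`**:
`E(g) ( Θ(((ρ₁ Z) ⊗ 1) η(X) (g,c)) + dE(φ_{w₀} Z) Θ(η(X)(g,c)) )`. [cite: Harder1987, §3.1] -/
theorem hasDerivAt_family_mul_expGL (h2 : Module.finrank ℚ K = 2) (c : BigHeckeGLn.FiniteAdelicGL 2 K)
    (X Z : Mat) (g : GL (Fin 2) ℂ) :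
    HasDerivAt (fun s : ℝ => coeffRepC K D.lam (g * expGL (s • Z)) (D.vec X (pt K (g * expGL (s • Z)) c)))
      (coeffRepC K D.lam g (D.Θ (mapModel D.d (D.evalW (pt K g c)) (mapModel D.d (D.ρ₁ Z : D.π.W →ₗ[ℂ] D.π.W) (D.ηX X))) +
        coeffPlaceLie K D.lam (complexPlace K) Z (D.vec X (pt K g c)))) 0 := by
  refine (D.hasDerivAt_family_mul_expGL_sum h2 c X Z g).congr_deriv ?_
  rw [Finset.sum_congr rfl fun l _ => Finset.sum_add_distrib, Finset.sum_add_distrib, map_add, add_comm]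
  congr 1
  · -- the `ρ₁`-part
    rw [theta_mapModel_evalW]
    simp only [map_sum, map_smul, mapModel_apply]
    refine Finset.sum_congr rfl fun l _ => Finset.sum_congr rfl fun m _ => ?_
    rw [coe_ρ₁]
  · -- the coefficient part
    rw [vec, theta_mapModel_evalW]
    simp only [map_sum, map_smul]

/-! ### The directions: `𝔭₀`, `𝔰𝔲(2)`, the centre -/

/-- Reading `(aut O₁).pVec i` entrywise through `ρ₁(x_i)`. [folklore] -/
theorem mapModel_ρ₁_Xmat (i : Fin 3) (u : model D.π.W D.d) :
    mapModel D.d (D.ρ₁ (Xmat i) : D.π.W →ₗ[ℂ] D.π.W) u = (aut D.O₁ D.d).pVec i u := by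
  refine Subtype.ext (funext fun l => funext fun m => ?_)
  have := mapModel_aut_pVec D.d D.O₁ (LinearMap.id) u l m i
  rw [LinearMap.id_apply] at this
  rw [mapModel_apply, D.O₁_eq] at *
  rw [pVec_opsOf] at this
  rw [← this]
  rfl

/-- Reading `(aut O₁).kVec α` entrywise through `ρ₁(y_α)`. [folklore] -/
theorem mapModel_ρ₁_Ymat (α : Fin 3) (u : model D.π.W D.d) :
    mapModel D.d (D.ρ₁ (Ymat α) : D.π.W →ₗ[ℂ] D.π.W) u = (aut D.O₁ D.d).kVec α u := by
  refine Subtype.ext (funext fun l => funext fun m => ?_)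
  have := mapModel_aut_kVec D.d D.O₁ (LinearMap.id) u l m α
  rw [LinearMap.id_apply] at this
  rw [mapModel_apply, D.O₁_eq] at *
  rw [kVec_opsOf] at this
  rw [← this]
  rfl

/-- The coefficient side: `dE(φ_{w₀} x_i) ∘ Θ = Θ ∘ (coeff d).pVec i`. [folklore] -/
theorem coeffPlaceLie_Xmat_theta (i : Fin 3) (u : model ℂ D.d) :
    coeffPlaceLie K D.lam (complexPlace K) (Xmat i) (D.Θ u) = D.Θ ((coeff (C := ℂ) D.d).pVec i u) := by
  rw [← pVec_opsOf (coeffPlaceLie K D.lam (complexPlace K)) i (D.Θ u)]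
  exact (D.hΘ.pVec i u).symm

/-- The coefficient side: `dE(φ_{w₀} y_α) ∘ Θ = Θ ∘ (coeff d).kVec α`. [folklore] -/
theorem coeffPlaceLie_Ymat_theta (α : Fin 3) (u : model ℂ D.d) :
    coeffPlaceLie K D.lam (complexPlace K) (Ymat α) (D.Θ u) = D.Θ ((coeff (C := ℂ) D.d).kVec α u) := by
  rw [← kVec_opsOf (coeffPlaceLie K D.lam (complexPlace K)) α (D.Θ u)]
  exact (D.hΘ.kVec α u).symm

/-- **The derivative along `x_i ∈ 𝔭₀` is `E(g) Θ((D_i η(X))(g, c))`** (Kuga's total operator `D_i`).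
[cite: BorelWallach2000, I §1.2] -/
theorem hasDerivAt_family_Xmat (h2 : Module.finrank ℚ K = 2) (c : BigHeckeGLn.FiniteAdelicGL 2 K)
    (X : Mat) (i : Fin 3) (g : GL (Fin 2) ℂ) :
    HasDerivAt (fun s : ℝ => coeffRepC K D.lam (g * expGL (s • Xmat i)) (D.vec X (pt K (g * expGL (s • Xmat i)) c)))
      (coeffRepC K D.lam g (D.Θ (mapModel D.d (D.evalW (pt K g c)) (D.setup.D i (D.ηX X))))) 0 := by
  refine (D.hasDerivAt_family_mul_expGL h2 c X (Xmat i) g).congr_deriv ?_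
  rw [mapModel_ρ₁_Xmat, vec, coeffPlaceLie_Xmat_theta, ← (intertwines_mapModel_coeff D.d (D.evalW (pt K g c))).pVec i,
    ← LinearEquiv.map_add, ← LinearMap.map_add]
  rfl

/-- **The derivative along `y_α ∈ 𝔰𝔲(2)` is `E(g) Θ(((π+ρ)(y_α) η(X))(g, c))`.** [cite: BorelWallach2000, I §1.2] -/
theorem hasDerivAt_family_Ymat (h2 : Module.finrank ℚ K = 2) (c : BigHeckeGLn.FiniteAdelicGL 2 K)
    (X : Mat) (α : Fin 3) (g : GL (Fin 2) ℂ) :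
    HasDerivAt (fun s : ℝ => coeffRepC K D.lam (g * expGL (s • Ymat α)) (D.vec X (pt K (g * expGL (s • Ymat α)) c)))
      (coeffRepC K D.lam g (D.Θ (mapModel D.d (D.evalW (pt K g c))
        (D.setup.πk α (D.ηX X) + D.setup.ρk α (D.ηX X))))) 0 := by
  refine (D.hasDerivAt_family_mul_expGL h2 c X (Ymat α) g).congr_deriv ?_
  rw [mapModel_ρ₁_Ymat, vec, coeffPlaceLie_Ymat_theta, ← (intertwines_mapModel_coeff D.d (D.evalW (pt K g c))).kVec α,
    ← LinearEquiv.map_add, ← LinearMap.map_add]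
  rfl

/-- **The derivative along the centre `1` vanishes** (`W` and `E_λ(ℂ)` have opposite scalars).
[cite: Harder1987, §3.1] -/
theorem hasDerivAt_family_one (h2 : Module.finrank ℚ K = 2) (c : BigHeckeGLn.FiniteAdelicGL 2 K)
    (X : Mat) (g : GL (Fin 2) ℂ) :
    HasDerivAt (fun s : ℝ => coeffRepC K D.lam (g * expGL (s • (1 : Mat))) (D.vec X (pt K (g * expGL (s • (1 : Mat))) c)))
      0 0 := by
  refine (D.hasDerivAt_family_mul_expGL h2 c X 1 g).congr_deriv ?_
  have hρ : mapModel D.d (D.ρ₁ 1 : D.π.W →ₗ[ℂ] D.π.W) (D.ηX X) = D.μ₁ • D.ηX X := by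
    refine Subtype.ext (funext fun l => funext fun m => ?_)
    rw [mapModel_apply, Submodule.coe_smul, Pi.smul_apply, Pi.smul_apply]
    exact D.hμ₁ _
  rw [hρ, map_smul, map_smul, vec, D.hμ₂, ← add_smul, add_neg_cancel, zero_smul, map_zero]

/-- **The derivative along `i·1` vanishes.** [cite: Harder1987, §3.1] -/
theorem hasDerivAt_family_I_one (h2 : Module.finrank ℚ K = 2) (c : BigHeckeGLn.FiniteAdelicGL 2 K)
    (X : Mat) (g : GL (Fin 2) ℂ) :
    HasDerivAt (fun s : ℝ => coeffRepC K D.lam (g * expGL (s • (I • (1 : Mat))))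
      (D.vec X (pt K (g * expGL (s • (I • (1 : Mat)))) c))) 0 0 := by
  refine (D.hasDerivAt_family_mul_expGL h2 c X (I • 1) g).congr_deriv ?_
  have hρ : mapModel D.d (D.ρ₁ (I • 1) : D.π.W →ₗ[ℂ] D.π.W) (D.ηX X) = D.ν₁ • D.ηX X := by
    refine Subtype.ext (funext fun l => funext fun m => ?_)
    rw [mapModel_apply, Submodule.coe_smul, Pi.smul_apply, Pi.smul_apply]
    exact D.hν₁ _
  rw [hρ, map_smul, map_smul, vec, D.hν₂, ← add_smul, add_neg_cancel, zero_smul, map_zero]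

end FamilyData

end GL2CESH

end Literature.NumberTheory.Automorphic

end
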